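import Summits.QuantumFields.BalabanUV.Beta.SymBorderWardSiteLawFluct
import Summits.QuantumFields.BalabanUV.Beta.SymSecondOrderTablesAn1

/-!
# `BalabanUV.Beta.SymBorderGaugeLegContactTwo` — binder row D1, (J-a) ∕ (COV) letters at ORDER 2: **THE FLUCTUATION-LEG PURE-GAUGE LAW OF THE (0.4)
# SECOND-ORDER BORDER TABLES — the real kernel `symVh2KerAt`, the packed family `symVh₂SAt`, and the ROW TABLE OF RECORD `symVh₂SAn1`** (kernel ∕ `MKer` level,
# every site; the order-2 twin of gan24-leaf-02's `GAN24.SymBorderGaugeLegContact`) (β sub-cell; D1 formalisation swarm LEAF PROVER 02, road «FP» ROUTE T,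
# (COV-m) order 2 — the letter behind the (STEP) door's `c2 ∕ d2 ∕ t2`)

HONEST FRAMING (cell charter, verbatim): «discharging BetaPertH makes Balaban's UV stability UNCONDITIONAL — a real
constructive-QFT result; it is NOT the continuum limit and NOT the Clay problem.»
HONEST DEPENDENCY: continuum YM on T⁴ ⇐ BetaPertH ∧ nine spine estimates (0/9 proved); BetaPertH ⇐ (D1) ∧ (D4) ∧ CAP+tail;
G-an2-4 gates asym, D1 and NE2/3/4.
DERIVED cell leaf ([folklore] re-indexing of a kernel identity through node 7a's packer), BY NAME over G4-B′σ `SymBorderWardSiteLawFluct.symVh2Tab_siteWard₀`, an1's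
S1∕S2 (`symVhKerAt ∕ symLinKerAt ∕ symHessKerAt`, `symHessKerAt_swap`, `symVh2KerAt`, `symVh₂SAt`, `symVh₂SAn1`), node 7a (`packVH`, `eq_smul_blk_of_off_eq_zero`),
an2's `SecondOrderSocketIdentification.atw`.  No statement of Bałaban's papers, no `[cite:]`, no `def`, no `Prop` fact; no VALUE of any table asserted; nothing of
JA-TABLE's identification of `symVh₂SAn1` with Bałaban's jet is used or claimed.  Discharges NO binder; 0∕4.  NOT D1, NOT `BetaPertH`, NOT continuum, NOT Clay.

WHAT (`m = symVhKerAt`, `q = symLinKerAt`, `h = symHessKerAt` — an1's MEAN kernels; `r₊ = L·y + ρ + L·e_μ`; bonds `g = (κ,u)`, `h′ = (κ′,u′)`, `g₊ = u + e_κ`):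
* §1 **`symVh2KerAt_div_fluct`** (`L ≠ 0`): `Σ_κ (s_sym((κ, z − e_κ); g, h′) − s_sym((κ, z); g, h′)) = 2·[z = h′₊]·m(h′, g) − [g = h′]·[z = g₊]·q(g) + [z = r₊]·(2·h(g, h′) + q(g)·q(h′))`.
* §2 **`gaugeLeg_symVh₂SAt_inr_inl`** (`1 ≤ L`; multiplier leg packed at `x`, fluctuation leg `(α, z)`, block `y = blk L x`): the same on the `(inr μ, inl α)`
  block of `symVh₂SAt ρ L κ u κ′ u′`, guarded by `[off L x = 0]`, with `r₊ = x + ρ + L·e_μ`.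
* §3 **`gaugeLeg_symVh₂SAn1_inr_inl`** (centred root `ρ_c`): for the ROW table `symVh₂SAn1 d L = atw (½ • (symVh₂SAt ρ_c + swap))`,
  `Σ_α (V₂ κ u κ′ u′ x (z − e_α) (inr μ) (inl α) − V₂ κ u κ′ u′ x z (inr μ) (inl α))
   = −[off L x = 0]·([z = h′₊]·m(h′, g) + [z = g₊]·m(g, h′) − [g = h′]·[z = g₊]·q(g) + [z = x + ρ_c + L·e_μ]·q(g)·q(h′))`
  — BOTH family bonds' TIP contacts, each carrying the first-order mean kernel WITH THE OTHER BOND IN THE FLUCTUATION SLOT and a MINUS sign; the diagonal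
  `g = h′` carrying `+q(g)` at `g₊`; the ROOT contact at the far end of the coarse bond carrying ONLY the product `−q(g)·q(h′)` — the `h_sym` terms of §1∕§2
  CANCEL under the `(κ,u) ↔ (κ′,u′)` symmetrisation (`symHessKerAt_swap`).
READING toward the door (bookkeeping; the torus face is the sequel): with U21's `hQ₁₂` (`Q₁₂ w w′ = −c₀ •` the bi-member of `W₁₂ = symVh₂SAn1 3 Lc` periodised in
its second bond, read on the `(coarsePt, inr) × (·, inl)` block), §3 is EXACTLY the per-site identity whose torus face is `c2`'s right block
(`(T·D)(a,s) = −Q₁₁^{β}(a,β′)[s = β′₊] − Q₁₁^{β′}(a,β)[s = β₊] + [β = β′]·c₀·Q₁₀(a,β)[s = β₊]` off the root — Q-d1leaf02-g23-1, an2 W-an2-g43-10) once `m` and `q`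
are read as the door's `Q₁₁`-member and `c₀·Q₁₀` row (my g17 `tsum_linSymAt_translate_eq`-type bridges), and whose root column gives `Db₂`'s PRODUCT weight
(C2-DET (r2): `κ₂ = κ₃ = 0`, `κ₁ ≠ 0` predicted).
Provenance: D1 formalisation swarm LEAF PROVER 02, unit b2b-balaban-beta-d1-formalise-leaf-02 gen 23, 2026-08-23; no existing file touched.
-/

namespace Summit.QuantumFields.BalabanUV.Beta.SymBorderGaugeLegContactTwo

open Finset
open scoped BigOperators Nat
open Literature.MathematicalPhysics.QuantumFieldTheory.Balaban1983to89
open Literature.MathematicalPhysics.QuantumFieldTheory.Balaban1983to89.Beta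
open AffineAveraging (Form1 Site unitVec)
open AveragingContours (blk off)
open AveragingContoursRooted (ctr)
open AveragingHessianKernels (Bond packVH packVH_inr_inl packVH_inl_inr eq_smul_blk_of_off_eq_zero)
open Summit.QuantumFields.BalabanUV.Beta.SymAveragingHessianCounts (symVhKerAt symLinKerAt symHessKerAt symVhCountAt symHessCountAt symLinCountAt
  symVhSAt symHessCountAt_swap symHessKerAt_swap)
open Summit.QuantumFields.BalabanUV.Beta.SymAveragingMixedJetTables (symVh2Tab symVh2KerAt symVh₂SAt)
open Summit.QuantumFields.BalabanUV.Beta.SymSecondOrderTablesAn1 (symVh₂SAn1)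
open Summit.QuantumFields.BalabanUV.Beta.SymBorderWardSiteLawFluct (symVh2Tab_siteWard₀)

variable {d : ℕ}

/-! ## §1 Kernel level, real currency: the fluctuation-slot law of `symVh2KerAt` in an1's MEAN kernels -/

section Kernel

open Classical in
/-- [folklore] **THE FLUCTUATION-SLOT LAW OF THE REAL (0.4) SECOND-ORDER BORDER KERNEL** `s_sym = symVh2KerAt` in the letters of an1's mean kernels
`m_sym = symVhKerAt` (`= VH∕(2(d!)²L^{2d})`), `q_sym = symLinKerAt` (`= LIN∕(d!·L^d)`), `h_sym = symHessKerAt` (`= HESS∕(2(d!)²L^d)`):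
`Σ_κ (s_sym((κ, z − e_κ); g, h) − s_sym((κ, z); g, h)) = 2·[z = h₊]·m_sym(h, g) − [g = h]·[z = g₊]·q_sym(g) + [z = r₊]·(2·h_sym(g, h) + q_sym(g)·q_sym(h))`. -/
theorem symVh2KerAt_div_fluct {L : ℕ} (hL : L ≠ 0) (ρ : Fin d → ℤ) (μ : Fin d) (y z : Fin d → ℤ) (g h : Bond d) :
    ∑ κ : Fin d, (symVh2KerAt ρ L μ y (κ, z - unitVec κ) g h - symVh2KerAt ρ L μ y (κ, z) g h)
      = 2 * (if h.2 + unitVec h.1 = z then (1 : ℝ) else 0) * symVhKerAt ρ L μ y h g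
        - (if g = h ∧ g.2 + unitVec g.1 = z then (1 : ℝ) else 0) * symLinKerAt ρ L μ y g
        + (if (L : ℤ) • y + ρ + (L : ℤ) • unitVec μ = z then (1 : ℝ) else 0)
            * (2 * symHessKerAt ρ L μ y g h + symLinKerAt ρ L μ y g * symLinKerAt ρ L μ y h) := by
  have hLq : (L : ℚ) ≠ 0 := Nat.cast_ne_zero.2 hL
  have hLr : (L : ℝ) ≠ 0 := Nat.cast_ne_zero.2 hL
  have hd : ((d ! : ℕ) : ℝ) ≠ 0 := by exact_mod_cast (Nat.factorial_pos d).ne'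
  have key := congrArg (fun q : ℚ => (q : ℝ)) (symVh2Tab_siteWard₀ hLq ρ μ y z g h)
  simp only [Rat.cast_sum, Rat.cast_sub, Rat.cast_add, Rat.cast_mul, Rat.cast_inv, Rat.cast_pow, Rat.cast_natCast, Rat.cast_intCast,
    apply_ite (Rat.cast : ℚ → ℝ), Rat.cast_one, Rat.cast_zero] at key
  have hs : ∀ κ : Fin d, symVh2KerAt ρ L μ y (κ, z - unitVec κ) g h - symVh2KerAt ρ L μ y (κ, z) g h
      = ((symVh2Tab ρ L μ y (κ, z - unitVec κ) g h : ℚ) : ℝ) - ((symVh2Tab ρ L μ y (κ, z) g h : ℚ) : ℝ) := fun κ => rfl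
  simp only [hs, key, symVhKerAt, symLinKerAt, symHessKerAt]
  field_simp
  ring

end Kernel

/-! ## §2 The packed table `symVh₂SAt`: the fluctuation-leg law on the `(inr μ, inl α)` block (fluctuation leg in the SECOND `MKer` slot) -/

section Packed

open Classical in
/-- [folklore] **THE FLUCTUATION-LEG LAW OF THE PACKED (0.4) SECOND-ORDER BORDER TABLE, `(inr μ, inl α)` BLOCK** (multiplier leg packed at `x`,
fluctuation leg `(α, z)`; family bonds `g = (κ, u)`, `h = (κ′, u′)`): `Σ_α (S₂ κ u κ′ u′ x (z − e_α) (inr μ) (inl α) − S₂ κ u κ′ u′ x z (inr μ) (inl α))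
= [off L x = 0] · (2·[z = u′ + e_{κ′}]·m_sym,μ(blk x)((κ′,u′), (κ,u)) − [(κ,u) = (κ′,u′)]·[z = u + e_κ]·q_sym(κ,u) + [z = x + ρ + L·e_μ]·(2·h_sym((κ,u),(κ′,u′)) + q_sym(κ,u)·q_sym(κ′,u′)))`. -/
theorem gaugeLeg_symVh₂SAt_inr_inl {L : ℕ} (hL : 1 ≤ L) (ρ : Fin (d + 1) → ℤ) (κ : Fin (d + 1)) (u : Fin (d + 1) → ℤ) (κ' : Fin (d + 1))
    (u' x z : Fin (d + 1) → ℤ) (μ : Fin (d + 1)) :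
    (∑ α, (symVh₂SAt ρ L κ u κ' u' x (z - unitVec α) (Sum.inr μ) (Sum.inl α) - symVh₂SAt ρ L κ u κ' u' x z (Sum.inr μ) (Sum.inl α)))
      = if off L x = 0 then
          2 * (if u' + unitVec κ' = z then (1 : ℝ) else 0) * symVhKerAt ρ L μ (blk L x) (κ', u') (κ, u)
          - (if (κ, u) = (κ', u') ∧ u + unitVec κ = z then (1 : ℝ) else 0) * symLinKerAt ρ L μ (blk L x) (κ, u)
          + (if x + ρ + (L : ℤ) • unitVec μ = z then (1 : ℝ) else 0)
              * (2 * symHessKerAt ρ L μ (blk L x) (κ, u) (κ', u') + symLinKerAt ρ L μ (blk L x) (κ, u) * symLinKerAt ρ L μ (blk L x) (κ', u'))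
        else 0 := by
  simp only [symVh₂SAt, packVH_inr_inl]
  by_cases hx : off L x = 0
  · simp only [hx, if_true]
    rw [symVh2KerAt_div_fluct (by omega), ← eq_smul_blk_of_off_eq_zero hL hx]
  · simp [hx]

end Packed

/-! ## §3 The row table `symVh₂SAn1` (anti-twin of the `(κ,u) ↔ (κ′,u′)` symmetrisation, centred root): the hess terms CANCEL, the mirrored tip appears -/

section Row

open Classical in
/-- [folklore] **THE FLUCTUATION-LEG LAW OF THE ROW BORDER TABLE `symVh₂SAn1`, `(inr μ, inl α)` BLOCK** (centred root `ρ_c = ctr (d+1) L`; multiplier leg at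
`x`, fluctuation leg `(α, z)`): `Σ_α (V₂ κ u κ′ u′ x (z − e_α) (inr μ) (inl α) − V₂ κ u κ′ u′ x z (inr μ) (inl α)) = −[off L x = 0] · ([z = u′ + e_{κ′}]·m_sym((κ′,u′),(κ,u))
+ [z = u + e_κ]·m_sym((κ,u),(κ′,u′)) − [(κ,u) = (κ′,u′)]·[z = u + e_κ]·q_sym(κ,u) + [z = x + ρ_c + L·e_μ]·q_sym(κ,u)·q_sym(κ′,u′))` — the two family bonds'
TIP contacts carry the FIRST-order mean kernel with the OTHER bond in the fluctuation slot, the diagonal carries the mean linear kernel, the ROOT contact at the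
far end of the coarse bond carries the PRODUCT of the two linear kernels, and the `h_sym` terms of §2 CANCEL (`symHessCountAt_swap`). -/
theorem gaugeLeg_symVh₂SAn1_inr_inl {L : ℕ} (hL : 1 ≤ L) (κ : Fin (d + 1)) (u : Fin (d + 1) → ℤ) (κ' : Fin (d + 1)) (u' x z : Fin (d + 1) → ℤ)
    (μ : Fin (d + 1)) :
    (∑ α, (symVh₂SAn1 d L κ u κ' u' x (z - unitVec α) (Sum.inr μ) (Sum.inl α) - symVh₂SAn1 d L κ u κ' u' x z (Sum.inr μ) (Sum.inl α)))
      = -(if off L x = 0 then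
          (if u' + unitVec κ' = z then (1 : ℝ) else 0) * symVhKerAt (ctr (d + 1) L) L μ (blk L x) (κ', u') (κ, u)
          + (if u + unitVec κ = z then (1 : ℝ) else 0) * symVhKerAt (ctr (d + 1) L) L μ (blk L x) (κ, u) (κ', u')
          - (if (κ, u) = (κ', u') ∧ u + unitVec κ = z then (1 : ℝ) else 0) * symLinKerAt (ctr (d + 1) L) L μ (blk L x) (κ, u)
          + (if x + ctr (d + 1) L + (L : ℤ) • unitVec μ = z then (1 : ℝ) else 0)
              * (symLinKerAt (ctr (d + 1) L) L μ (blk L x) (κ, u) * symLinKerAt (ctr (d + 1) L) L μ (blk L x) (κ', u'))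
        else 0) := by
  -- the `(inr μ, inl α)` entry of the row table: minus the symmetrised packed entry (the anti-twin reads the `(inl, inr)` entry at `(z, x)`)
  have hent : ∀ (w : Fin (d + 1) → ℤ) (α : Fin (d + 1)), symVh₂SAn1 d L κ u κ' u' x w (Sum.inr μ) (Sum.inl α)
      = -((1 / 2 : ℝ) * (symVh₂SAt (ctr (d + 1) L) L κ u κ' u' x w (Sum.inr μ) (Sum.inl α)
          + symVh₂SAt (ctr (d + 1) L) L κ' u' κ u x w (Sum.inr μ) (Sum.inl α))) := by
    intro w α
    simp only [symVh₂SAn1, SecondOrderSocketIdentification.atw, Pi.smul_apply, Pi.add_apply, smul_eq_mul, symVh₂SAt, packVH_inl_inr, packVH_inr_inl]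
  have hsum : (∑ α, (symVh₂SAn1 d L κ u κ' u' x (z - unitVec α) (Sum.inr μ) (Sum.inl α) - symVh₂SAn1 d L κ u κ' u' x z (Sum.inr μ) (Sum.inl α)))
      = -((1 / 2 : ℝ) * ((∑ α, (symVh₂SAt (ctr (d + 1) L) L κ u κ' u' x (z - unitVec α) (Sum.inr μ) (Sum.inl α)
            - symVh₂SAt (ctr (d + 1) L) L κ u κ' u' x z (Sum.inr μ) (Sum.inl α)))
          + ∑ α, (symVh₂SAt (ctr (d + 1) L) L κ' u' κ u x (z - unitVec α) (Sum.inr μ) (Sum.inl α)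
            - symVh₂SAt (ctr (d + 1) L) L κ' u' κ u x z (Sum.inr μ) (Sum.inl α)))) := by
    simp only [hent, Finset.mul_sum, ← Finset.sum_add_distrib, ← Finset.sum_neg_distrib]
    refine Finset.sum_congr rfl fun α _ => by ring
  rw [hsum, gaugeLeg_symVh₂SAt_inr_inl hL, gaugeLeg_symVh₂SAt_inr_inl hL]
  by_cases hx : off L x = 0
  · simp only [hx, if_true]
    rw [symHessKerAt_swap (ctr (d + 1) L) L μ (blk L x) (κ, u) (κ', u')]
    by_cases hgh : (κ, u) = (κ', u')
    · have hκ : κ' = κ := (congrArg Prod.fst hgh).symm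
      have hu : u' = u := (congrArg Prod.snd hgh).symm
      subst hκ; subst hu
      simp only [true_and]
      split_ifs <;> ring
    · have hhg : ¬ (κ', u') = (κ, u) := fun e => hgh e.symm
      simp only [hgh, hhg, false_and, if_false]
      split_ifs <;> ring
  · simp [hx]

end Row

end Summit.QuantumFields.BalabanUV.Beta.SymBorderGaugeLegContactTwo
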